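import Summits.Ventures.Crystal3D.Theorems.StickyWulffConstantGenericWallFloorHRowEndFarApartHolds
import HarnessLib

/-!
# Leaf closer: lane T `TexShadow` registered stub `stub_hRowEndFarApart` (crux `TextureLiminfV5`, stmt-Ventures-23912)

HONEST FRAMING. Venture `Summits/Ventures/Crystal3D` (cell `crystal3d-full`), route `route-Ventures-StickyWulffConstant`, lane T, line
`TexShadow` v8.18.  The registered input stub `stub_hRowEndFarApart : HRowEndFarApart (21 / 25)` of the LAYER ROWS line is the tree theorem
`Summit.Ventures.Crystal3D.Theorems.hRowEndFarApart_holds` (…GenericWallFloorHRowEndFarApartHolds, p730228; 19480-p2 g14); this LEAF module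
lands it under the stub's fully-qualified name (cf-p1 RULING (ccxxxix): the module's import closure contains '…TextureLiminfL12Local', so it
cannot be folded into the skeleton; a leaf closer is the registry's by-name route).  Nothing new is proved; F-C1 not moved.
-/

namespace Summit.Ventures.Crystal3D.Cruxes.TextureLiminf.TexShadow

/-- **`stub_hRowEndFarApart` BY NAME**: the repaired LAYER ROWS input `HRowEndFarApart (21/25)` holds (19480-p2 g14, `hRowEndFarApart_holds`). -/
theorem stub_hRowEndFarApart : Summit.Ventures.Crystal3D.Theorems.HRowEndFarApart (21 / 25) :=
  Summit.Ventures.Crystal3D.Theorems.hRowEndFarApart_holds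

end Summit.Ventures.Crystal3D.Cruxes.TextureLiminf.TexShadow
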